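import Literature.Computability.MetaComplexity.RefutationCNFPolyTime
import Literature.Computability.Complexity.CodeFPOrderKit
import Literature.Computability.Complexity.CodeFPStringKit
import Literature.Computability.Complexity.E3InstanceMachine
import HarnessLib

/-!
# The Atserias–Müller gadget `G(F) = RREF(F, 13n²)` is polynomial-time computable

Discharge of the named fact `rrefGadget_polyTime` of `RefutationCNF.lean`
[Atserias–Müller 2020, Thm 2: "there is a polynomial-time computable function `G` …", §6:
`G(F) := RREF(F, 13n²)`] by the routine machine construction its docstring describes, written in
the typed calculus `CodeFP` of `Complexity/CodeFP.lean` (programs on codes, [Arora–Barak 2009,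
§1.3]): sort the occurring variables of `F` (`RefCNF.sortedVars`, insertion sort after `dedup`),
form the unary budget `s = 13n²`, write the clause families (A1)–(A24) of
[Atserias–Müller 2020, Appendix] as bounded loops over `[s]`, `{0} ∪ [n]`, `{0} ∪ [m]`, and
renumber the variables along `RefVar.code` (a change of presentation on codes).

Main results:

* `RefCNF.blocksFP rel` — `(X, F, 1ˢ) ↦` the clause blocks (A1)–(A21) (`rel = false`: `REF`,
  `rel = true`: the guarded blocks of `RREF`) and `RefCNF.rrefRawFP` — `(X, F, 1ˢ) ↦ RREF`, as
  programs on codes over the variables `RefVar` (coded by `RefVar.code`);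
* `codeFP_refCNF`, `codeFP_rrefCNF` — `(F, 1ˢ) ↦ REF(F,s)` and `(F, 1ˢ) ↦ RREF(F,s)` are
  polynomial-time on CNF codes (`s` in unary);
* `codeFP_rrefGadget : CodeFP cnfE cnfE rrefGadget` and
  **`rrefGadget_polyTime_holds : rrefGadget_polyTime`** — the named fact;
* `rrefGadget_encode_length_le'` — the unconditional output-length bound
  (`rrefGadget_encode_length_le` of `RefutationCNFPolyTime.lean` with its hypothesis discharged).

History: an earlier discharge (p46356, target `RefutationCNFProofs.lean`) was overwritten by a
racing proposal (see the module docstring of `RefutationCNFPolyTime.lean`); this file is the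
re-landing under the new name requested there. Nothing in `RefutationCNF.lean` is changed.

## References

* A. Atserias, M. Müller, *Automating Resolution is NP-hard*, J. ACM 67(5) (2020), Art. 31;
  arXiv:1904.02991 — Thm 2 (`G` polynomial-time computable), §6 (`G(F) := RREF(F, 13n²)`),
  Appendix (clause tables (A1)–(A24)).
* S. Arora, B. Barak, *Computational Complexity: A Modern Approach*, CUP 2009, §1.3
  (polynomial-time string functions; composition; bounded loops).
-/

namespace Literature.Computability.MetaComplexity

open _root_.Computability Complexity CodeFP
open Complexity.Expander.E3LC (cnfE cnfE_eq litE rawClausesFP)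

namespace RefCNF

/-! ### Codes of the `REF`/`RREF` variables and literals

Encodings used throughout (written out in full, no abbreviations are introduced): an optional
index `i : Option ℕ` is coded by `natE (RefVar.optCode i)` (`none ↦ 0`, `some k ↦ k+1`), a
variable `x : RefVar` by `natE (RefVar.code x)`, a literal over `RefVar` by
`pairE (fun x => natE (RefVar.code x)) bitE`, and the context `(X, F, 1ˢ)` of the blocks by
`pairE (rawE natE) (pairE (rawE (rawE litE)) unE)`. -/

/-- The code `none ↦ 0`, `some k ↦ k+1` of optional indices is injective. [folklore] -/
theorem optNE_injective : Function.Injective (fun o => natE (RefVar.optCode o)) := by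
  intro a b h
  have h' := natE_injective h
  cases a <;> cases b <;> simp_all [RefVar.optCode]

/-- Pointwise concatenation of two list-valued programs. [cite: AroraBarak2009, §1.3
(composition of polynomial-time functions)] -/
theorem appendFP {α β : Type} {eα : α → List Bool} {e : β → List Bool}
    {f g : α → List β} (hf : CodeFP eα (rawE e) f) (hg : CodeFP eα (rawE e) g) :
    CodeFP eα (rawE e) (fun a => f a ++ g a) :=
  (rawAppend _).comp (hf.pair hg)

/-- `(a, b) ↦ 6·⟨a, b⟩ + r` on binary numerals (Cantor pairing, then the kind tag `r` of
`RefVar.code`). [cite: AroraBarak2009, §1.3 (arithmetic in polynomial time)] -/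
theorem tagPairFP (r : ℕ) :
    CodeFP (pairE natE natE) natE (fun p => 6 * Nat.pair p.1 p.2 + r) := by
  have ha : CodeFP (pairE natE natE) natE (fun p => p.1) := fst _ _
  have hb : CodeFP (pairE natE natE) natE (fun p => p.2) := snd _ _
  have hpair : CodeFP (pairE natE natE) natE (fun p => Nat.pair p.1 p.2) :=
    (natLt.ite (natAdd.comp ((natMul.comp (hb.pair hb)).pair ha))
      (natAdd.comp ((natAdd.comp ((natMul.comp (ha.pair ha)).pair ha)).pair hb))).congr fun p => by
      simp [Nat.pair]
  exact (natAdd.comp ((natMul.comp ((const _ 6).pair hpair)).pair (const _ r))).congr fun _ => rfl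

/-- `u ↦ P[u]` on codes. [cite: AtseriasMuller2020, §5 (variables P of RREF)] -/
theorem pFP : CodeFP natE (fun x => natE (RefVar.code x)) RefVar.P :=
  (natMul.comp ((const natE 6).pair (CodeFP.id natE))).recodeOut fun _ => rfl

/-- `(u, i) ↦ (u, optCode i)`: the identity on codes. [folklore] -/
theorem optArgFP :
    CodeFP (pairE natE (fun o => natE (RefVar.optCode o))) (pairE natE natE) (fun p => (p.1, RefVar.optCode p.2)) :=
  transparent fun _ => rfl

/-- `(u, i) ↦ V[u,i]` on codes. [cite: AtseriasMuller2020, §4 (variables of REF)] -/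
theorem vFP : CodeFP (pairE natE (fun o => natE (RefVar.optCode o))) (fun x => natE (RefVar.code x)) (fun p => RefVar.V p.1 p.2) :=
  ((tagPairFP 2).comp optArgFP).recodeOut fun _ => rfl

/-- `(u, j) ↦ I[u,j]` on codes. [cite: AtseriasMuller2020, §4 (variables of REF)] -/
theorem iFP : CodeFP (pairE natE (fun o => natE (RefVar.optCode o))) (fun x => natE (RefVar.code x)) (fun p => RefVar.I p.1 p.2) :=
  ((tagPairFP 3).comp optArgFP).recodeOut fun _ => rfl

/-- `(u, v) ↦ L[u,v]` on codes. [cite: AtseriasMuller2020, §4 (variables of REF)] -/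
theorem lFP : CodeFP (pairE natE (fun o => natE (RefVar.optCode o))) (fun x => natE (RefVar.code x)) (fun p => RefVar.L p.1 p.2) :=
  ((tagPairFP 4).comp optArgFP).recodeOut fun _ => rfl

/-- `(u, v) ↦ R[u,v]` on codes. [cite: AtseriasMuller2020, §4 (variables of REF)] -/
theorem rFP : CodeFP (pairE natE (fun o => natE (RefVar.optCode o))) (fun x => natE (RefVar.code x)) (fun p => RefVar.R p.1 p.2) :=
  ((tagPairFP 5).comp optArgFP).recodeOut fun _ => rfl

/-- `(u, i, b) ↦ D[u,i,b]` on codes. [cite: AtseriasMuller2020, §4 (variables of REF)] -/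
theorem dFP : CodeFP (pairE natE (pairE natE bitE)) (fun x => natE (RefVar.code x)) (fun p => RefVar.D p.1 p.2.1 p.2.2) := by
  have hb : CodeFP (pairE natE (pairE natE bitE)) natE (fun p => p.2.2.toNat) :=
    (((snd _ _).snd').ite (const _ 1) (const _ 0)).congr fun p => by cases p.2.2 <;> rfl
  have h2 : CodeFP (pairE natE (pairE natE bitE)) natE (fun p => 2 * p.2.1 + p.2.2.toNat) :=
    natAdd.comp ((natMul.comp ((const _ 2).pair (snd _ _).fst')).pair hb)
  exact ((tagPairFP 1).comp ((fst _ _).pair h2)).recodeOut fun _ => rfl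

/-- `k ↦ some k` on codes (`+1`). [folklore] -/
theorem someFP : CodeFP natE (fun o => natE (RefVar.optCode o)) some :=
  (natAdd.comp ((CodeFP.id natE).pair (const natE 1))).recodeOut fun _ => rfl

/-- The guard `pfx rel u` on codes. [cite: AtseriasMuller2020, Appendix (the literal ¬P(u))] -/
theorem pfxFP (rel : Bool) : CodeFP natE (rawE (pairE (fun x => natE (RefVar.code x)) bitE)) (pfx rel) := by
  cases rel
  · exact (const natE ([] : Clause RefVar)).congr fun u => by simp [pfx]
  · exact ((rawSingleton (pairE (fun x => natE (RefVar.code x)) bitE)).comp (pFP.pair (const natE false))).congr fun u => by simp [pfx]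

/-- `1ᵏ ↦ [none, some 0, …, some (k-1)]` on codes (the range `[0, …, k]`).
[cite: AroraBarak2009, §1.3 (bounded loops)] -/
theorem optRangeFP : CodeFP unE (rawE (fun o => natE (RefVar.optCode o))) optRange :=
  (urange.comp unSucc).recodeOut fun k => by
    simp [optRange, rawE, List.range_succ_eq_map, RefVar.optCode, Function.comp_def]

/-- `1ˢ ↦` the last line `[u < s | u + 1 = s]`. [cite: AroraBarak2009, §1.3 (bounded loops)] -/
theorem lastLineFP : CodeFP unE (rawE natE) (fun s => (List.range s).filter (· + 1 = s)) := by
  have hp : CodeFP (pairE natE natE) bitE (fun t => decide (t.2 + 1 = t.1)) :=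
    natEq.comp ((natAdd.comp ((snd _ _).pair (const _ 1))).pair (fst _ _))
  exact ((filter hp).comp (natOfUn.pair urange)).congr fun _ => rfl

/-- Renumbering along `RefVar.code` is the identity on codes. [folklore] -/
theorem toNatFP : CodeFP (rawE (rawE (pairE (fun x => natE (RefVar.code x)) bitE))) (rawE (rawE litE)) toNat :=
  transparent fun φ => by
    simp only [toNat, rawE, List.map_map]
    congr 1
    refine List.map_congr_left fun C _ => ?_
    simp only [Function.comp_apply, rawE, List.map_map]
    rfl

/-- **The occurring variables in increasing order**, `F ↦ sortedVars F`, on codes: `dedup` of the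
variable occurrences followed by insertion sort. [cite: AroraBarak2009, §1.3] -/
theorem sortedVarsFP : CodeFP (rawE (rawE litE)) (rawE natE) sortedVars := by
  have hvars : CodeFP (rawE (rawE litE)) (rawE natE) (fun F => (F.flatten.map Prod.fst).dedup) :=
    (dedup natE natE_injective).comp ((map₀ (fst natE bitE)).comp (flatten litE))
  have hle : CodeFP (pairE unitE (pairE natE natE)) bitE (fun t => decide (t.2.1 ≤ t.2.2)) :=
    natLe.comp (snd _ _)
  refine ((insertionSortCtx (σ := Unit) (eσ := unitE) (r := fun _ a b => a ≤ b) hle).comp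
    ((const _ ()).pair hvars)).congr fun F => ?_
  set l := ((F.flatten.map Prod.fst).dedup).insertionSort (· ≤ ·) with hl
  have hnd : l.Nodup := (List.perm_insertionSort _ _).nodup_iff.2 (List.nodup_dedup _)
  have hsorted : l.Pairwise (· ≤ ·) := List.pairwise_insertionSort _ _
  have hset : l.toFinset = CNF.vars F := by
    ext v
    simp [hl, CNF.vars, (List.perm_insertionSort (· ≤ ·) _).mem_iff]
  show l = sortedVars F
  rw [sortedVars, ← hset]
  exact ((List.toFinset_sort (· ≤ ·) hnd).2 hsorted).symm

/-! ### The clause families on codes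

Each family is a bounded loop nest; the generic shapes are proved once, parameterised by the
variable constructor `C ∈ {V, I, L, R}` (all of type `ℕ → Option ℕ → RefVar`).
Inputs: `1ˢ`, or `(1ˢ, 1ᵏ)` with `k ∈ {n, m}`, or the context `(X, F, 1ˢ)` for (A19). Loop
contexts are repacked at each level to exactly the indices used below it. -/

/-- Shape of (A1)–(A4): `u ↦ pfx u ∨ ⋁_{i ∈ {0} ∪ [k]} C[u,i]`.
[cite: AtseriasMuller2020, Appendix, clauses (A1)–(A4)] -/
theorem famDefFP (rel : Bool) {C : ℕ → Option ℕ → RefVar}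
    (hC : CodeFP (pairE natE (fun o => natE (RefVar.optCode o))) (fun x => natE (RefVar.code x)) (fun p => C p.1 p.2)) :
    CodeFP (pairE unE unE) (rawE (rawE (pairE (fun x => natE (RefVar.code x)) bitE)))
      (fun q => (List.range q.1).map fun u =>
        pfx rel u ++ (optRange q.2).map fun i => (C u i, true)) := by
  have hlit : CodeFP (pairE (pairE unE natE) (fun o => natE (RefVar.optCode o))) (pairE (fun x => natE (RefVar.code x)) bitE) (fun t => (C t.1.2 t.2, true)) :=
    (hC.comp (((fst _ _).snd').pair (snd _ _))).pair (const _ true)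
  have hbody : CodeFP (pairE unE natE) (rawE (pairE (fun x => natE (RefVar.code x)) bitE))
      (fun t => pfx rel t.2 ++ (optRange t.1).map fun i => (C t.2 i, true)) :=
    (rawAppend _).comp (((pfxFP rel).comp (snd _ _)).pair
      ((map hlit).comp ((CodeFP.id _).pair (optRangeFP.comp (fst _ _)))))
  exact (map hbody).comp ((snd _ _).pair (urange.comp (fst _ _)))

/-- Shape of (A5)–(A8): `¬C[u,i] ∨ ¬C[u,i']` over `u ∈ [s]` and ordered pairs
`i ≠ i' ∈ {0} ∪ [k]`. [cite: AtseriasMuller2020, Appendix, clauses (A5)–(A8)] -/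
theorem famSVFP (rel : Bool) {C : ℕ → Option ℕ → RefVar}
    (hC : CodeFP (pairE natE (fun o => natE (RefVar.optCode o))) (fun x => natE (RefVar.code x)) (fun p => C p.1 p.2)) :
    CodeFP (pairE unE unE) (rawE (rawE (pairE (fun x => natE (RefVar.code x)) bitE)))
      (fun q => (List.range q.1).flatMap fun u => (optRange q.2).flatMap fun i =>
        ((optRange q.2).filter (· ≠ i)).map fun i' =>
          pfx rel u ++ [(C u i, false), (C u i', false)]) := by
  have hcl : CodeFP (pairE (pairE natE (fun o => natE (RefVar.optCode o))) (fun o => natE (RefVar.optCode o))) (rawE (pairE (fun x => natE (RefVar.code x)) bitE))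
      (fun t => pfx rel t.1.1 ++ [(C t.1.1 t.1.2, false), (C t.1.1 t.2, false)]) :=
    (rawAppend _).comp (((pfxFP rel).comp (fst _ _).fst').pair ((rawCons _).comp
      (((hC.comp (fst _ _)).pair (const _ false)).pair
        ((rawSingleton _).comp ((hC.comp (((fst _ _).fst').pair (snd _ _))).pair
          (const _ false))))))
  have hne : CodeFP (pairE (fun o => natE (RefVar.optCode o)) (fun o => natE (RefVar.optCode o))) bitE (fun t => decide (t.2 ≠ t.1)) :=
    ((eq optNE_injective).comp ((snd _ _).pair (fst _ _))).not.congr fun _ => by simp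
  have h3 : CodeFP (pairE (pairE unE natE) (fun o => natE (RefVar.optCode o))) (rawE (rawE (pairE (fun x => natE (RefVar.code x)) bitE)))
      (fun c => ((optRange c.1.1).filter (· ≠ c.2)).map fun i' =>
        pfx rel c.1.2 ++ [(C c.1.2 c.2, false), (C c.1.2 i', false)]) :=
    (map hcl).comp ((((fst _ _).snd').pair (snd _ _)).pair
      ((filter hne).comp ((snd _ _).pair (optRangeFP.comp ((fst _ _).fst')))))
  have h2 : CodeFP (pairE unE natE) (rawE (rawE (pairE (fun x => natE (RefVar.code x)) bitE)))
      (fun c => (optRange c.1).flatMap fun i => ((optRange c.1).filter (· ≠ i)).map fun i' =>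
        pfx rel c.2 ++ [(C c.2 i, false), (C c.2 i', false)]) :=
    (flatten _).comp ((map h3).comp ((CodeFP.id _).pair (optRangeFP.comp (fst _ _))))
  exact (flatten _).comp ((map h2).comp ((snd _ _).pair (urange.comp (fst _ _))))

/-- Shape of (A9)–(A12): `(¬)I[u,0] ∨ (¬)C[u,0]` for `u ∈ [s]`.
[cite: AtseriasMuller2020, Appendix, clauses (A9)–(A12)] -/
theorem famPairFP (rel b : Bool) {C : ℕ → Option ℕ → RefVar}
    (hC : CodeFP (pairE natE (fun o => natE (RefVar.optCode o))) (fun x => natE (RefVar.code x)) (fun p => C p.1 p.2)) :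
    CodeFP unE (rawE (rawE (pairE (fun x => natE (RefVar.code x)) bitE)))
      (fun s => (List.range s).map fun u =>
        pfx rel u ++ [(RefVar.I u none, b), (C u none, b)]) := by
  have hcl : CodeFP natE (rawE (pairE (fun x => natE (RefVar.code x)) bitE))
      (fun u => pfx rel u ++ [(RefVar.I u none, b), (C u none, b)]) :=
    (rawAppend _).comp ((pfxFP rel).pair ((rawCons _).comp
      (((iFP.comp ((CodeFP.id natE).pair (const _ none))).pair (const _ b)).pair
        ((rawSingleton _).comp ((hC.comp ((CodeFP.id natE).pair (const _ none))).pair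
          (const _ b))))))
  exact (map₀ hcl).comp urange

/-- Shape of (A13)–(A14): `¬C[u,v]` for `u ≤ v` in `[s]`.
[cite: AtseriasMuller2020, Appendix, clauses (A13)–(A14)] -/
theorem famOrdFP (rel : Bool) {C : ℕ → Option ℕ → RefVar}
    (hC : CodeFP (pairE natE (fun o => natE (RefVar.optCode o))) (fun x => natE (RefVar.code x)) (fun p => C p.1 p.2)) :
    CodeFP unE (rawE (rawE (pairE (fun x => natE (RefVar.code x)) bitE)))
      (fun s => (List.range s).flatMap fun u => ((List.range s).filter (u ≤ ·)).map fun v =>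
        pfx rel u ++ [(C u (some v), false)]) := by
  have hcl : CodeFP (pairE natE natE) (rawE (pairE (fun x => natE (RefVar.code x)) bitE))
      (fun t => pfx rel t.1 ++ [(C t.1 (some t.2), false)]) :=
    (rawAppend _).comp (((pfxFP rel).comp (fst _ _)).pair ((rawSingleton _).comp
      ((hC.comp ((fst _ _).pair (someFP.comp (snd _ _)))).pair (const _ false))))
  have h2 : CodeFP (pairE unE natE) (rawE (rawE (pairE (fun x => natE (RefVar.code x)) bitE)))
      (fun c => ((List.range c.1).filter (c.2 ≤ ·)).map fun v =>
        pfx rel c.2 ++ [(C c.2 (some v), false)]) :=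
    (map hcl).comp ((snd _ _).pair ((filter natLe).comp ((snd _ _).pair (urange.comp (fst _ _)))))
  exact (flatten _).comp ((map h2).comp ((CodeFP.id unE).pair urange))

/-- Shape of (A15)–(A16): `¬C[u,v] ∨ ¬V[u,i] ∨ D[v,i,b]` over `u, v ∈ [s]`, `i ∈ [n]`.
[cite: AtseriasMuller2020, Appendix, clauses (A15)–(A16)] -/
theorem famCutFP (rel b : Bool) {C : ℕ → Option ℕ → RefVar}
    (hC : CodeFP (pairE natE (fun o => natE (RefVar.optCode o))) (fun x => natE (RefVar.code x)) (fun p => C p.1 p.2)) :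
    CodeFP (pairE unE unE) (rawE (rawE (pairE (fun x => natE (RefVar.code x)) bitE)))
      (fun q => (List.range q.1).flatMap fun u => (List.range q.1).flatMap fun v =>
        (List.range q.2).map fun i => pfx rel u ++ pfx rel v ++
          [(C u (some v), false), (RefVar.V u (some i), false), (RefVar.D v i b, true)]) := by
  have hu : CodeFP (pairE (pairE natE natE) natE) natE (fun t => t.1.1) := (fst _ _).fst'
  have hv : CodeFP (pairE (pairE natE natE) natE) natE (fun t => t.1.2) := (fst _ _).snd'
  have hi : CodeFP (pairE (pairE natE natE) natE) natE (fun t => t.2) := snd _ _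
  have hcl : CodeFP (pairE (pairE natE natE) natE) (rawE (pairE (fun x => natE (RefVar.code x)) bitE))
      (fun t => pfx rel t.1.1 ++ pfx rel t.1.2 ++ [(C t.1.1 (some t.1.2), false),
        (RefVar.V t.1.1 (some t.2), false), (RefVar.D t.1.2 t.2 b, true)]) :=
    (rawAppend _).comp (((rawAppend _).comp (((pfxFP rel).comp hu).pair
      ((pfxFP rel).comp hv))).pair
      ((rawCons _).comp (((hC.comp (hu.pair (someFP.comp hv))).pair (const _ false)).pair
        ((rawCons _).comp (((vFP.comp (hu.pair (someFP.comp hi))).pair (const _ false)).pair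
          ((rawSingleton _).comp ((dFP.comp (hv.pair (hi.pair (const _ b)))).pair
            (const _ true))))))))
  have h3 : CodeFP (pairE (pairE unE natE) natE) (rawE (rawE (pairE (fun x => natE (RefVar.code x)) bitE)))
      (fun c => (List.range c.1.1).map fun i => pfx rel c.1.2 ++ pfx rel c.2 ++
        [(C c.1.2 (some c.2), false), (RefVar.V c.1.2 (some i), false),
          (RefVar.D c.2 i b, true)]) :=
    (map hcl).comp ((((fst _ _).snd').pair (snd _ _)).pair (urange.comp ((fst _ _).fst')))
  have h2 : CodeFP (pairE (pairE unE unE) natE) (rawE (rawE (pairE (fun x => natE (RefVar.code x)) bitE)))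
      (fun c => (List.range c.1.1).flatMap fun v => (List.range c.1.2).map fun i =>
        pfx rel c.2 ++ pfx rel v ++ [(C c.2 (some v), false), (RefVar.V c.2 (some i), false),
          (RefVar.D v i b, true)]) :=
    (flatten _).comp ((map h3).comp ((((fst _ _).snd').pair (snd _ _)).pair
      (urange.comp ((fst _ _).fst'))))
  exact (flatten _).comp ((map h2).comp ((CodeFP.id _).pair (urange.comp (fst _ _))))

/-- Shape of (A17)–(A18): `¬C[u,v] ∨ ¬V[u,i] ∨ ¬D[v,i',b] ∨ D[u,i',b]` over
`u, v ∈ [s]`, `i ≠ i' ∈ [n]`, `b ∈ {0,1}`.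
[cite: AtseriasMuller2020, Appendix, clauses (A17)–(A18)] -/
theorem famKeepFP (rel : Bool) {C : ℕ → Option ℕ → RefVar}
    (hC : CodeFP (pairE natE (fun o => natE (RefVar.optCode o))) (fun x => natE (RefVar.code x)) (fun p => C p.1 p.2)) :
    CodeFP (pairE unE unE) (rawE (rawE (pairE (fun x => natE (RefVar.code x)) bitE)))
      (fun q => (List.range q.1).flatMap fun u => (List.range q.1).flatMap fun v =>
        (List.range q.2).flatMap fun i => ((List.range q.2).filter (· ≠ i)).flatMap fun i' =>
          [false, true].map fun b => pfx rel u ++ pfx rel v ++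
            [(C u (some v), false), (RefVar.V u (some i), false),
              (RefVar.D v i' b, false), (RefVar.D u i' b, true)]) := by
  have hu : CodeFP (pairE (pairE (pairE (pairE natE natE) natE) natE) bitE) natE
      (fun t => t.1.1.1.1) := (((fst _ _).fst').fst').fst'
  have hv : CodeFP (pairE (pairE (pairE (pairE natE natE) natE) natE) bitE) natE
      (fun t => t.1.1.1.2) := (((fst _ _).fst').fst').snd'
  have hi : CodeFP (pairE (pairE (pairE (pairE natE natE) natE) natE) bitE) natE
      (fun t => t.1.1.2) := ((fst _ _).fst').snd'
  have hi' : CodeFP (pairE (pairE (pairE (pairE natE natE) natE) natE) bitE) natE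
      (fun t => t.1.2) := (fst _ _).snd'
  have hb : CodeFP (pairE (pairE (pairE (pairE natE natE) natE) natE) bitE) bitE
      (fun t => t.2) := snd _ _
  have hcl : CodeFP (pairE (pairE (pairE (pairE natE natE) natE) natE) bitE) (rawE (pairE (fun x => natE (RefVar.code x)) bitE))
      (fun t => pfx rel t.1.1.1.1 ++ pfx rel t.1.1.1.2 ++
        [(C t.1.1.1.1 (some t.1.1.1.2), false), (RefVar.V t.1.1.1.1 (some t.1.1.2), false),
          (RefVar.D t.1.1.1.2 t.1.2 t.2, false), (RefVar.D t.1.1.1.1 t.1.2 t.2, true)]) :=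
    (rawAppend _).comp (((rawAppend _).comp (((pfxFP rel).comp hu).pair
      ((pfxFP rel).comp hv))).pair
      ((rawCons _).comp (((hC.comp (hu.pair (someFP.comp hv))).pair (const _ false)).pair
        ((rawCons _).comp (((vFP.comp (hu.pair (someFP.comp hi))).pair (const _ false)).pair
          ((rawCons _).comp (((dFP.comp (hv.pair (hi'.pair hb))).pair (const _ false)).pair
            ((rawSingleton _).comp ((dFP.comp (hu.pair (hi'.pair hb))).pair
              (const _ true))))))))))
  have h5 : CodeFP (pairE (pairE (pairE natE natE) natE) natE) (rawE (rawE (pairE (fun x => natE (RefVar.code x)) bitE)))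
      (fun c => [false, true].map fun b => pfx rel c.1.1.1 ++ pfx rel c.1.1.2 ++
        [(C c.1.1.1 (some c.1.1.2), false), (RefVar.V c.1.1.1 (some c.1.2), false),
          (RefVar.D c.1.1.2 c.2 b, false), (RefVar.D c.1.1.1 c.2 b, true)]) :=
    (map hcl).comp ((CodeFP.id _).pair (const _ [false, true]))
  have hne : CodeFP (pairE natE natE) bitE (fun t => decide (t.2 ≠ t.1)) :=
    (natEq.comp ((snd _ _).pair (fst _ _))).not.congr fun _ => by simp
  have h4 : CodeFP (pairE (pairE unE (pairE natE natE)) natE) (rawE (rawE (pairE (fun x => natE (RefVar.code x)) bitE)))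
      (fun c => ((List.range c.1.1).filter (· ≠ c.2)).flatMap fun i' =>
        [false, true].map fun b => pfx rel c.1.2.1 ++ pfx rel c.1.2.2 ++
          [(C c.1.2.1 (some c.1.2.2), false), (RefVar.V c.1.2.1 (some c.2), false),
            (RefVar.D c.1.2.2 i' b, false), (RefVar.D c.1.2.1 i' b, true)]) :=
    (flatten _).comp ((map h5).comp ((((fst _ _).snd').pair (snd _ _)).pair
      ((filter hne).comp ((snd _ _).pair (urange.comp ((fst _ _).fst'))))))
  have h3 : CodeFP (pairE (pairE unE natE) natE) (rawE (rawE (pairE (fun x => natE (RefVar.code x)) bitE)))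
      (fun c => (List.range c.1.1).flatMap fun i =>
        ((List.range c.1.1).filter (· ≠ i)).flatMap fun i' =>
          [false, true].map fun b => pfx rel c.1.2 ++ pfx rel c.2 ++
            [(C c.1.2 (some c.2), false), (RefVar.V c.1.2 (some i), false),
              (RefVar.D c.2 i' b, false), (RefVar.D c.1.2 i' b, true)]) :=
    (flatten _).comp ((map h4).comp ((((fst _ _).fst').pair (((fst _ _).snd').pair
      (snd _ _))).pair (urange.comp ((fst _ _).fst'))))
  have h2 : CodeFP (pairE (pairE unE unE) natE) (rawE (rawE (pairE (fun x => natE (RefVar.code x)) bitE)))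
      (fun c => (List.range c.1.1).flatMap fun v => (List.range c.1.2).flatMap fun i =>
        ((List.range c.1.2).filter (· ≠ i)).flatMap fun i' =>
          [false, true].map fun b => pfx rel c.2 ++ pfx rel v ++
            [(C c.2 (some v), false), (RefVar.V c.2 (some i), false),
              (RefVar.D v i' b, false), (RefVar.D c.2 i' b, true)]) :=
    (flatten _).comp ((map h3).comp ((((fst _ _).snd').pair (snd _ _)).pair
      (urange.comp ((fst _ _).fst'))))
  exact (flatten _).comp ((map h2).comp ((CodeFP.id _).pair (urange.comp (fst _ _))))

/-- (A19) on codes, from the context `(X, F, 1ˢ)`: `¬I[u,j] ∨ D[u, idx_X x, b]` for `u ∈ [s]`,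
`j ∈ [m]` and each literal `(x, b)` of `F[j]`.
[cite: AtseriasMuller2020, Appendix, clause (A19)] -/
theorem A19FP (rel : Bool) :
    CodeFP (pairE (rawE natE) (pairE (rawE (rawE litE)) unE)) (rawE (rawE (pairE (fun x => natE (RefVar.code x)) bitE))) (fun κ => A19 rel κ.1 κ.2.1 κ.2.2) := by
  have hX : CodeFP (pairE (pairE (rawE natE) (pairE natE natE)) litE) (rawE natE)
      (fun t => t.1.1) := (fst _ _).fst'
  have hu : CodeFP (pairE (pairE (rawE natE) (pairE natE natE)) litE) natE
      (fun t => t.1.2.1) := ((fst _ _).snd').fst'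
  have hj : CodeFP (pairE (pairE (rawE natE) (pairE natE natE)) litE) natE
      (fun t => t.1.2.2) := ((fst _ _).snd').snd'
  have hidx : CodeFP (pairE (pairE (rawE natE) (pairE natE natE)) litE) natE
      (fun t => t.1.1.idxOf t.2.1) := idxOfNat.comp ((snd _ _).fst'.pair hX)
  have hcl : CodeFP (pairE (pairE (rawE natE) (pairE natE natE)) litE) (rawE (pairE (fun x => natE (RefVar.code x)) bitE))
      (fun t => pfx rel t.1.2.1 ++ [(RefVar.I t.1.2.1 (some t.1.2.2), false),
        (RefVar.D t.1.2.1 (t.1.1.idxOf t.2.1) t.2.2, true)]) :=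
    (rawAppend _).comp (((pfxFP rel).comp hu).pair ((rawCons _).comp
      (((iFP.comp (hu.pair (someFP.comp hj))).pair (const _ false)).pair
        ((rawSingleton _).comp ((dFP.comp (hu.pair (hidx.pair (snd _ _).snd'))).pair
          (const _ true))))))
  have h3 : CodeFP (pairE (pairE (pairE (rawE natE) (rawE (rawE litE))) natE) natE)
      (rawE (rawE (pairE (fun x => natE (RefVar.code x)) bitE))) (fun c => (c.1.1.2.getD c.2 []).map fun l => pfx rel c.1.2 ++
        [(RefVar.I c.1.2 (some c.2), false), (RefVar.D c.1.2 (c.1.1.1.idxOf l.1) l.2, true)]) :=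
    (map hcl).comp (((((fst _ _).fst').fst').pair (((fst _ _).snd').pair (snd _ _))).pair
      ((rawGetD (rawE litE) (rawE_nil _)).comp ((((fst _ _).fst').snd').pair (snd _ _))))
  have h2 : CodeFP (pairE (pairE (rawE natE) (rawE (rawE litE))) natE) (rawE (rawE (pairE (fun x => natE (RefVar.code x)) bitE)))
      (fun c => (List.range c.1.2.length).flatMap fun j => (c.1.2.getD j []).map fun l =>
        pfx rel c.2 ++ [(RefVar.I c.2 (some j), false),
          (RefVar.D c.2 (c.1.1.idxOf l.1) l.2, true)]) :=
    (flatten _).comp ((map h3).comp ((CodeFP.id _).pair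
      (urange.comp ((ulength (rawE litE)).comp ((fst _ _).snd')))))
  exact (flatten _).comp ((map h2).comp (((fst _ _).pair ((snd _ _).fst')).pair
    (urange.comp ((snd _ _).snd'))))

/-- (A20) on codes: `¬D[u,i,0] ∨ ¬D[u,i,1]` for `u ∈ [s]`, `i ∈ [n]`.
[cite: AtseriasMuller2020, Appendix, clause (A20)] -/
theorem A20FP (rel : Bool) :
    CodeFP (pairE unE unE) (rawE (rawE (pairE (fun x => natE (RefVar.code x)) bitE))) (fun q => A20 rel q.1 q.2) := by
  have hD : ∀ b, CodeFP (pairE natE natE) (pairE (fun x => natE (RefVar.code x)) bitE) (fun t => (RefVar.D t.1 t.2 b, false)) := fun b =>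
    (dFP.comp ((fst _ _).pair ((snd _ _).pair (const _ b)))).pair (const _ false)
  have hcl : CodeFP (pairE natE natE) (rawE (pairE (fun x => natE (RefVar.code x)) bitE))
      (fun t => pfx rel t.1 ++ [(RefVar.D t.1 t.2 false, false), (RefVar.D t.1 t.2 true, false)]) :=
    (rawAppend _).comp (((pfxFP rel).comp (fst _ _)).pair
      ((rawCons _).comp ((hD false).pair ((rawSingleton _).comp (hD true)))))
  have h2 : CodeFP (pairE unE natE) (rawE (rawE (pairE (fun x => natE (RefVar.code x)) bitE))) (fun c => (List.range c.1).map fun i =>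
      pfx rel c.2 ++ [(RefVar.D c.2 i false, false), (RefVar.D c.2 i true, false)]) :=
    (map hcl).comp ((snd _ _).pair (urange.comp (fst _ _)))
  exact (flatten _).comp ((map h2).comp ((snd _ _).pair (urange.comp (fst _ _))))

/-- (A21) on codes: `¬D[s,i,b]` for the last line, `i ∈ [n]`, `b ∈ {0,1}`.
[cite: AtseriasMuller2020, Appendix, clause (A21)] -/
theorem A21FP (rel : Bool) :
    CodeFP (pairE unE unE) (rawE (rawE (pairE (fun x => natE (RefVar.code x)) bitE))) (fun q => A21 rel q.1 q.2) := by
  have hcl : CodeFP (pairE (pairE natE natE) bitE) (rawE (pairE (fun x => natE (RefVar.code x)) bitE))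
      (fun t => pfx rel t.1.1 ++ [(RefVar.D t.1.1 t.1.2 t.2, false)]) :=
    (rawAppend _).comp (((pfxFP rel).comp ((fst _ _).fst')).pair ((rawSingleton _).comp
      ((dFP.comp (((fst _ _).fst').pair (((fst _ _).snd').pair (snd _ _)))).pair
        (const _ false))))
  have h3 : CodeFP (pairE natE natE) (rawE (rawE (pairE (fun x => natE (RefVar.code x)) bitE)))
      (fun c => [false, true].map fun b => pfx rel c.1 ++ [(RefVar.D c.1 c.2 b, false)]) :=
    (map hcl).comp ((CodeFP.id _).pair (const _ [false, true]))
  have h2 : CodeFP (pairE unE natE) (rawE (rawE (pairE (fun x => natE (RefVar.code x)) bitE)))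
      (fun c => (List.range c.1).flatMap fun i => [false, true].map fun b =>
        pfx rel c.2 ++ [(RefVar.D c.2 i b, false)]) :=
    (flatten _).comp ((map h3).comp ((snd _ _).pair (urange.comp (fst _ _))))
  exact (flatten _).comp ((map h2).comp ((snd _ _).pair (lastLineFP.comp (fst _ _))))

/-- Shape of (A22)–(A23): `¬P[u] ∨ ¬C[u,v] ∨ P[v]` over `u, v ∈ [s]`.
[cite: AtseriasMuller2020, Appendix, clauses (A22)–(A23)] -/
theorem famActFP {C : ℕ → Option ℕ → RefVar}
    (hC : CodeFP (pairE natE (fun o => natE (RefVar.optCode o))) (fun x => natE (RefVar.code x)) (fun p => C p.1 p.2)) :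
    CodeFP unE (rawE (rawE (pairE (fun x => natE (RefVar.code x)) bitE)))
      (fun s => (List.range s).flatMap fun u => (List.range s).map fun v =>
        [(RefVar.P u, false), (C u (some v), false), (RefVar.P v, true)]) := by
  have hcl : CodeFP (pairE natE natE) (rawE (pairE (fun x => natE (RefVar.code x)) bitE))
      (fun t => [(RefVar.P t.1, false), (C t.1 (some t.2), false), (RefVar.P t.2, true)]) :=
    (rawCons _).comp (((pFP.comp (fst _ _)).pair (const _ false)).pair ((rawCons _).comp
      (((hC.comp ((fst _ _).pair (someFP.comp (snd _ _)))).pair (const _ false)).pair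
        ((rawSingleton _).comp ((pFP.comp (snd _ _)).pair (const _ true))))))
  have h2 : CodeFP (pairE unE natE) (rawE (rawE (pairE (fun x => natE (RefVar.code x)) bitE))) (fun c => (List.range c.1).map fun v =>
      [(RefVar.P c.2, false), (C c.2 (some v), false), (RefVar.P v, true)]) :=
    (map hcl).comp ((snd _ _).pair (urange.comp (fst _ _)))
  exact (flatten _).comp ((map h2).comp ((CodeFP.id unE).pair urange))

/-- (A24) on codes: the unit clause `P[s]`. [cite: AtseriasMuller2020, Appendix, clause (A24)] -/
theorem A24FP : CodeFP unE (rawE (rawE (pairE (fun x => natE (RefVar.code x)) bitE))) A24 :=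
  (map₀ ((rawSingleton _).comp (pFP.pair (const natE true)))).comp lastLineFP

/-! ### The blocks, `REF`, `RREF` and the gadget -/

/-- **The clause blocks (A1)–(A21) on codes**, from the context `(X, F, 1ˢ)`
(`n := |X|`, `m := |F|`). [cite: AtseriasMuller2020, Appendix (Clauses of REF / RREF);
AroraBarak2009, §1.3] -/
theorem blocksFP (rel : Bool) :
    CodeFP (pairE (rawE natE) (pairE (rawE (rawE litE)) unE)) (rawE (rawE (pairE (fun x => natE (RefVar.code x)) bitE))) (fun κ => blocks rel κ.1 κ.2.1 κ.2.2) := by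
  have hs : CodeFP (pairE (rawE natE) (pairE (rawE (rawE litE)) unE)) unE (fun κ => κ.2.2) := (snd _ _).snd'
  have hsn : CodeFP (pairE (rawE natE) (pairE (rawE (rawE litE)) unE)) (pairE unE unE) (fun κ => (κ.2.2, κ.1.length)) :=
    hs.pair ((ulength natE).comp (fst _ _))
  have hsm : CodeFP (pairE (rawE natE) (pairE (rawE (rawE litE)) unE)) (pairE unE unE) (fun κ => (κ.2.2, κ.2.1.length)) :=
    hs.pair ((ulength (rawE litE)).comp ((snd _ _).fst'))
  have hss : CodeFP (pairE (rawE natE) (pairE (rawE (rawE litE)) unE)) (pairE unE unE) (fun κ => (κ.2.2, κ.2.2)) := hs.pair hs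
  have b1 : CodeFP (pairE (rawE natE) (pairE (rawE (rawE litE)) unE)) (rawE (rawE (pairE (fun x => natE (RefVar.code x)) bitE))) (fun κ => A1 rel κ.2.2 κ.1.length) :=
    ((famDefFP rel vFP).comp hsn).congr fun κ => by simp only [A1]
  have b2 : CodeFP (pairE (rawE natE) (pairE (rawE (rawE litE)) unE)) (rawE (rawE (pairE (fun x => natE (RefVar.code x)) bitE))) (fun κ => A2 rel κ.2.2 κ.2.1.length) :=
    ((famDefFP rel iFP).comp hsm).congr fun κ => by simp only [A2]
  have b3 : CodeFP (pairE (rawE natE) (pairE (rawE (rawE litE)) unE)) (rawE (rawE (pairE (fun x => natE (RefVar.code x)) bitE))) (fun κ => A3 rel κ.2.2) :=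
    ((famDefFP rel lFP).comp hss).congr fun κ => by simp only [A3]
  have b4 : CodeFP (pairE (rawE natE) (pairE (rawE (rawE litE)) unE)) (rawE (rawE (pairE (fun x => natE (RefVar.code x)) bitE))) (fun κ => A4 rel κ.2.2) :=
    ((famDefFP rel rFP).comp hss).congr fun κ => by simp only [A4]
  have b5 : CodeFP (pairE (rawE natE) (pairE (rawE (rawE litE)) unE)) (rawE (rawE (pairE (fun x => natE (RefVar.code x)) bitE))) (fun κ => A5 rel κ.2.2 κ.1.length) :=
    ((famSVFP rel vFP).comp hsn).congr fun κ => by simp only [A5]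
  have b6 : CodeFP (pairE (rawE natE) (pairE (rawE (rawE litE)) unE)) (rawE (rawE (pairE (fun x => natE (RefVar.code x)) bitE))) (fun κ => A6 rel κ.2.2 κ.2.1.length) :=
    ((famSVFP rel iFP).comp hsm).congr fun κ => by simp only [A6]
  have b7 : CodeFP (pairE (rawE natE) (pairE (rawE (rawE litE)) unE)) (rawE (rawE (pairE (fun x => natE (RefVar.code x)) bitE))) (fun κ => A7 rel κ.2.2) :=
    ((famSVFP rel lFP).comp hss).congr fun κ => by simp only [A7]
  have b8 : CodeFP (pairE (rawE natE) (pairE (rawE (rawE litE)) unE)) (rawE (rawE (pairE (fun x => natE (RefVar.code x)) bitE))) (fun κ => A8 rel κ.2.2) :=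
    ((famSVFP rel rFP).comp hss).congr fun κ => by simp only [A8]
  have b9 : CodeFP (pairE (rawE natE) (pairE (rawE (rawE litE)) unE)) (rawE (rawE (pairE (fun x => natE (RefVar.code x)) bitE))) (fun κ => A9 rel κ.2.2) :=
    ((famPairFP rel false vFP).comp hs).congr fun κ => by simp only [A9]
  have b10 : CodeFP (pairE (rawE natE) (pairE (rawE (rawE litE)) unE)) (rawE (rawE (pairE (fun x => natE (RefVar.code x)) bitE))) (fun κ => A10 rel κ.2.2) :=
    ((famPairFP rel true vFP).comp hs).congr fun κ => by simp only [A10]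
  have b11 : CodeFP (pairE (rawE natE) (pairE (rawE (rawE litE)) unE)) (rawE (rawE (pairE (fun x => natE (RefVar.code x)) bitE))) (fun κ => A11 rel κ.2.2) :=
    ((famPairFP rel false lFP).comp hs).congr fun κ => by simp only [A11]
  have b12 : CodeFP (pairE (rawE natE) (pairE (rawE (rawE litE)) unE)) (rawE (rawE (pairE (fun x => natE (RefVar.code x)) bitE))) (fun κ => A12 rel κ.2.2) :=
    ((famPairFP rel false rFP).comp hs).congr fun κ => by simp only [A12]
  have b13 : CodeFP (pairE (rawE natE) (pairE (rawE (rawE litE)) unE)) (rawE (rawE (pairE (fun x => natE (RefVar.code x)) bitE))) (fun κ => A13 rel κ.2.2) :=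
    ((famOrdFP rel lFP).comp hs).congr fun κ => by simp only [A13]
  have b14 : CodeFP (pairE (rawE natE) (pairE (rawE (rawE litE)) unE)) (rawE (rawE (pairE (fun x => natE (RefVar.code x)) bitE))) (fun κ => A14 rel κ.2.2) :=
    ((famOrdFP rel rFP).comp hs).congr fun κ => by simp only [A14]
  have b15 : CodeFP (pairE (rawE natE) (pairE (rawE (rawE litE)) unE)) (rawE (rawE (pairE (fun x => natE (RefVar.code x)) bitE))) (fun κ => A15 rel κ.2.2 κ.1.length) :=
    ((famCutFP rel false lFP).comp hsn).congr fun κ => by simp only [A15]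
  have b16 : CodeFP (pairE (rawE natE) (pairE (rawE (rawE litE)) unE)) (rawE (rawE (pairE (fun x => natE (RefVar.code x)) bitE))) (fun κ => A16 rel κ.2.2 κ.1.length) :=
    ((famCutFP rel true rFP).comp hsn).congr fun κ => by simp only [A16]
  have b17 : CodeFP (pairE (rawE natE) (pairE (rawE (rawE litE)) unE)) (rawE (rawE (pairE (fun x => natE (RefVar.code x)) bitE))) (fun κ => A17 rel κ.2.2 κ.1.length) :=
    ((famKeepFP rel lFP).comp hsn).congr fun κ => by simp only [A17]
  have b18 : CodeFP (pairE (rawE natE) (pairE (rawE (rawE litE)) unE)) (rawE (rawE (pairE (fun x => natE (RefVar.code x)) bitE))) (fun κ => A18 rel κ.2.2 κ.1.length) :=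
    ((famKeepFP rel rFP).comp hsn).congr fun κ => by simp only [A18]
  have b19 : CodeFP (pairE (rawE natE) (pairE (rawE (rawE litE)) unE)) (rawE (rawE (pairE (fun x => natE (RefVar.code x)) bitE))) (fun κ => A19 rel κ.1 κ.2.1 κ.2.2) := A19FP rel
  have b20 : CodeFP (pairE (rawE natE) (pairE (rawE (rawE litE)) unE)) (rawE (rawE (pairE (fun x => natE (RefVar.code x)) bitE))) (fun κ => A20 rel κ.2.2 κ.1.length) :=
    ((A20FP rel).comp hsn).congr fun κ => by simp only [A20]
  have b21 : CodeFP (pairE (rawE natE) (pairE (rawE (rawE litE)) unE)) (rawE (rawE (pairE (fun x => natE (RefVar.code x)) bitE))) (fun κ => A21 rel κ.2.2 κ.1.length) :=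
    ((A21FP rel).comp hsn).congr fun κ => by simp only [A21]
  have c := appendFP (appendFP (appendFP (appendFP (appendFP (appendFP (appendFP (appendFP
    (appendFP (appendFP (appendFP (appendFP (appendFP (appendFP (appendFP (appendFP (appendFP
    (appendFP (appendFP (appendFP b1 b2) b3) b4) b5) b6) b7) b8) b9) b10) b11) b12) b13) b14) b15)
    b16) b17) b18) b19) b20) b21
  refine c.congr fun κ => ?_
  simp only [blocks]

/-- **`(X, F, 1ˢ) ↦ RREF(F,s)`** (structured, variable list `X`) on codes.
[cite: AtseriasMuller2020, §5 and Appendix (Clauses of RREF); AroraBarak2009, §1.3] -/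
theorem rrefRawFP : CodeFP (pairE (rawE natE) (pairE (rawE (rawE litE)) unE)) (rawE (rawE (pairE (fun x => natE (RefVar.code x)) bitE))) (fun κ => RefCNF.rref κ.1 κ.2.1 κ.2.2) := by
  have hs : CodeFP (pairE (rawE natE) (pairE (rawE (rawE litE)) unE)) unE (fun κ => κ.2.2) := (snd _ _).snd'
  have a22 : CodeFP (pairE (rawE natE) (pairE (rawE (rawE litE)) unE)) (rawE (rawE (pairE (fun x => natE (RefVar.code x)) bitE))) (fun κ => A22 κ.2.2) :=
    ((famActFP lFP).comp hs).congr fun κ => by simp only [A22]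
  have a23 : CodeFP (pairE (rawE natE) (pairE (rawE (rawE litE)) unE)) (rawE (rawE (pairE (fun x => natE (RefVar.code x)) bitE))) (fun κ => A23 κ.2.2) :=
    ((famActFP rFP).comp hs).congr fun κ => by simp only [A23]
  have a24 : CodeFP (pairE (rawE natE) (pairE (rawE (rawE litE)) unE)) (rawE (rawE (pairE (fun x => natE (RefVar.code x)) bitE))) (fun κ => A24 κ.2.2) := A24FP.comp hs
  have c := appendFP (appendFP (appendFP (blocksFP true) a22) a23) a24
  refine c.congr fun κ => ?_
  simp only [RefCNF.rref]

/-- The context `(sortedVars F, F, 1ˢ)` from `(F, 1ˢ)` on codes. [cite: AroraBarak2009, §1.3] -/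
theorem ctxFP : CodeFP (pairE cnfE unE) (pairE (rawE natE) (pairE (rawE (rawE litE)) unE)) (fun p => (sortedVars p.1, p.1, p.2)) :=
  (sortedVarsFP.comp (rawClausesFP.comp (fst _ _))).pair
    ((rawClausesFP.comp (fst _ _)).pair (snd _ _))

/-- From structured clause lists over `RefVar` to CNF codes over `ℕ` (renumbering by
`RefVar.code`, then length headers). [cite: AroraBarak2009, §1.3] -/
theorem toCnfNatFP : CodeFP (rawE (rawE (pairE (fun x => natE (RefVar.code x)) bitE))) cnfE toNat := by
  have h : CodeFP (rawE (rawE litE)) cnfE (fun φ => φ) :=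
    ((listOfRaw (listE litE)).comp (map₀ (listOfRaw litE))).congr fun φ => by simp
  exact (h.comp toNatFP).congr fun _ => rfl

end RefCNF

open Complexity.Expander.E3LC (cnfE cnfE_eq litE rawClausesFP)

/-- **`(F, 1ˢ) ↦ REF(F,s)` is polynomial-time computable** on CNF codes (`s` in unary).
[cite: AtseriasMuller2020, §4 (REF(F,s)); AroraBarak2009, §1.3] -/
theorem codeFP_refCNF : CodeFP (pairE cnfE unE) cnfE (fun p => refCNF p.1 p.2) :=
  (RefCNF.toCnfNatFP.comp ((RefCNF.blocksFP false).comp RefCNF.ctxFP)).congr fun _ => by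
    simp only [refCNF, RefCNF.ref]

/-- **`(F, 1ˢ) ↦ RREF(F,s)` is polynomial-time computable** on CNF codes (`s` in unary).
[cite: AtseriasMuller2020, §5 (RREF(F,s)); AroraBarak2009, §1.3] -/
theorem codeFP_rrefCNF : CodeFP (pairE cnfE unE) cnfE (fun p => rrefCNF p.1 p.2) :=
  (RefCNF.toCnfNatFP.comp (RefCNF.rrefRawFP.comp RefCNF.ctxFP)).congr fun _ => by
    simp only [rrefCNF]

/-- **The gadget `G(F) = RREF(F, 13n²)` as a program on CNF codes** (`n = |vars F|`, the budget
`13n²` formed in unary from the sorted variable list). [cite: AtseriasMuller2020, Thm 2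
(G polynomial-time computable) and §6 (G(F) := RREF(F,13n²))] -/
theorem codeFP_rrefGadget : CodeFP cnfE cnfE rrefGadget := by
  have hn : CodeFP cnfE unE (fun F => (RefCNF.sortedVars F).length) :=
    (ulength natE).comp (RefCNF.sortedVarsFP.comp rawClausesFP)
  have hs : CodeFP cnfE unE (fun F => 13 * (CNF.vars F).card ^ 2) :=
    (unMul.comp ((const _ 13).pair (unMul.comp (hn.pair hn)))).congr fun F => by
      simp only [RefCNF.length_sortedVars, pow_two]
  exact (codeFP_rrefCNF.comp ((CodeFP.id cnfE).pair hs)).congr fun F => by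
    simp only [rrefGadget, id_eq]

/-- **[Atserias–Müller 2020, Thm 2]: `G` is polynomial-time computable** — the named fact
`rrefGadget_polyTime` of `RefutationCNF.lean` holds. [cite: AtseriasMuller2020, Thm 2
(a polynomial-time computable function G), §6] -/
theorem rrefGadget_polyTime_holds : rrefGadget_polyTime := by
  have h := codeFP_rrefGadget
  rw [← cnfE_eq] at h
  exact h

/-- **The code of `G(F)` is polynomially bounded in the code of `F`**, unconditionally
(`rrefGadget_encode_length_le` with its hypothesis discharged).
[cite: AtseriasMuller2020, §6 (G(F) has size at most n^q); AroraBarak2009, §1.3] -/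
theorem rrefGadget_encode_length_le' :
    ∃ p : Polynomial ℕ, ∀ F : CNF ℕ,
      (encodingCNF.encode (rrefGadget F)).length ≤ p.eval (encodingCNF.encode F).length :=
  rrefGadget_encode_length_le rrefGadget_polyTime_holds

end Literature.Computability.MetaComplexity
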